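import Summits.ValiantsHypothesis.ValiantsHypothesis.Theorems.LacunarySymmetroidMatrixDescartesCensusDefs
import Summits.ValiantsHypothesis.ValiantsHypothesis.Theorems.LacunarySymmetroidMatrixDescartesStubDescartesCeiling
import Summits.ValiantsHypothesis.ValiantsHypothesis.Theorems.LacunarySymmetroidMatrixDescartesStubNegRoots

/-!
# Crux `MatrixDescartes` (stmt-ValiantsHypothesis-18050), line `halving-sweep-sesqui-law` —
# STUB 5 `stub_recursionArith : HalvingRecursion → SesquiLaw` (arithmetic), PROVED — the proof file

Line skeleton: ideator val-idea-2 (g0), `run/shared/lean/pub/ideators/val-idea-2/lines/line-halving-sweep-sesqui-law.lean`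
r1 (sha16 `4a2515cbaafbeae4`; namespace `…Cruxes.MatrixDescartes.HalvingSweep`), crux idea
`Cruxes/MatrixDescartes/Ideas/halving-sweep-sesqui-law.md`; critic gate crit-1 / crit-2 PASS-WITH-PRICE
(2026-08-27).  The line is PUBLISHED, NOT registered on 18050 (line of record = `Lines/Lift.lean`), so this is a
`--supports stmt-ValiantsHypothesis-18050` HELPER.  This file is DEFINITION-FREE: `sesquiLaw_of_halvingRecursion` is
the stub `HalvingRecursion → SesquiLaw` with the two line-local `Prop`s UNFOLDED to their bodies over the tree
predicates `PosRootLawAt` / `RealRootLawAt` (definitionally the line's statement); the by-name-rule-v2 wrapper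
(`def HalvingRecursion`, `def SesquiLaw`, `def Stmt.stub_recursionArith` verbatim + `theorem stub_recursionArith :
Stmt.stub_recursionArith`) is the companion file `…HalvingSweepStubRecursionArith.lean`, through which the line file
closes its `sorry` by `exact`.

**Statement.**  `HalvingRecursion` (the line's halving recursion in `ζ`-currency): there are `a c : ℕ` such that
for all `m K k B₁ B₂` with `c (⌊log₂ m⌋ + 1) ≤ K + 1`, `0 < k ≤ K`, the rows `ζ(m,k) ≤ B₁` and `ζ(m,K+1−k) ≤ B₂`
give `ζ(m,K+1) ≤ 2 (B₂ + m + 2 (a m (B₁ + B₂ + m) + ((K+1)(m+1))^a))`.  `SesquiLaw`: there is `C : ℕ` with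
`M(m,K) ≤ 2 ^ (C ((⌊log₂ m⌋+1)(⌊log₂ K⌋+1) + (⌊log₂ m⌋+1)²))` for all formats `(m, K)` (all real zeros).
Proved here: `HalvingRecursion → SesquiLaw`.

**Proof (pure arithmetic; the line card's step "run the recursion with `k = ⌈(K+1)/2⌉` down to
`K₀ = c(log₂ m + 1)`, finish with Descartes, convert").**  Fix `m`, put `L = ⌊log₂ m⌋`, `T = max (c(L+1)) 2`
(base threshold).  DYADIC INDUCTION on `j` (`level_bound`): every format with `1 ≤ N ≤ 2^j T` letters satisfies
`ζ(m,N) ≤ G_j`, where `G_0 = (m+1)^(T−1)` (Descartes: `ζ(m,N) ≤ C(m+N−1,m) − 1 ≤ (m+1)^(N−1)`, tree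
`stub_descartesCeiling` and `C(m+n,m) ≤ (m+1)^n`) and `G_{j+1} = 2 (G_j + m + 2 (a m (2 G_j + m) + (2^{j+1} T (m+1))^a))`
(the recursion at `N = K+1 > 2^j T ≥ T ≥ c(L+1)`, split `k = ⌊N/2⌋`, both halves `≤ ⌈N/2⌉ ≤ 2^j T`), with the
LEVEL BOUND `G_j ≤ (3 + 8am)^j · ((m+1)^(T−1) + 2m + 4am² + 4 (2^j T (m+1))^a)`.  ENVELOPE (`envelope`): with
`E = (L+1)(⌊log₂K⌋+1) + (L+1)²` and `W = 2^E` one has `2^(L+1), 2^(⌊log₂K⌋+1), 2^((L+1)²), 2^((L+1)(⌊log₂K⌋+1)) ≤ W`,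
whence at level `j = ⌊log₂ K⌋ + 1` (`K < 2^j ≤ 2^j T`): `(3+8am)^j ≤ W^(8a+3)`, `(m+1)^(T−1) ≤ W^(c+1)`,
`T ≤ W^(c+2)`, `4 (2^j T (m+1))^a ≤ W^(a(c+4)+2)`, so `2 G_j + 1 ≤ W^(a(c+4) + 9a + c + 11)`.  Finally
`M ≤ 2 ζ-bound + 1` by the reflection `X ↦ −X` (tree `stub_negRoots`), and the `K = 0` format has no zeros.  The
constant is `C = a(c+4) + 9a + c + 11`.  Elementary; imports are the Theses-free census modules only (the Descartes
ceiling and the reflection step are used directly through the tree's `stub_descartesCeiling` / `stub_negRoots`, so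
no module of a route cone is imported); axioms `propext`, `Classical.choice`, `Quot.sound`.

HONEST FRAMING: an M-sized ARITHMETIC/bookkeeping stub (instrument tier, «arithmetic glue») of a published,
unregistered ideator line on the V1 crux.  It is an implication between two OPEN statements of the line; it proves
NOTHING about `HalvingRecursion`, the line's load-bearing `GuardedWiggleLaw`, `HalfSweepIneq`, the crux
`LacunarySymmetroid.MatrixDescartes`, Conjecture B (`KPlusLogSqLaw`) or the doors; rung currency 18050 open → open;
`VP ≠ VNP` is NOT proved and nothing here is progress on it.  No definitions, no named facts.
-/

-- `Summit.ValiantsHypothesis.ValiantsHypothesis.…` is the tree's mandated single-conjunct layout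
-- (Sub = Summit), so the duplicated namespace component is intended.
set_option linter.dupNamespace false
set_option autoImplicit false

namespace Summit.ValiantsHypothesis.ValiantsHypothesis.Theorems.LacunarySymmetroidMatrixDescartes

open Summit.ValiantsHypothesis.ValiantsHypothesis.Theorems.MatrixDescartes.Negative (PosRootLawAt)
open scoped BigOperators

namespace HalvingSweep

/-! ## The Descartes base in `(m+1)`-power form -/

/-- **Descartes base in `(m+1)`-power form**: `C(m+n, m) ≤ (m+1)^n` (induction on `n` via Pascal's rule and
`C(m+n, n+1)·(n+1) = C(m+n, n)·m`). [folklore] -/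
theorem choose_add_le_succ_pow (m n : ℕ) : Nat.choose (m + n) m ≤ (m + 1) ^ n := by
  rw [Nat.choose_symm_add]
  induction n with
  | zero => simp
  | succ n ih =>
    have h1 : Nat.choose (m + n) (n + 1) * (n + 1) = Nat.choose (m + n) n * m := by
      rw [Nat.choose_succ_right_eq, Nat.add_sub_cancel]
    have h2 : Nat.choose (m + n) (n + 1) ≤ Nat.choose (m + n) n * m :=
      calc Nat.choose (m + n) (n + 1) ≤ Nat.choose (m + n) (n + 1) * (n + 1) :=
            Nat.le_mul_of_pos_right _ (Nat.succ_pos n)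
        _ = Nat.choose (m + n) n * m := h1
    calc Nat.choose (m + (n + 1)) (n + 1)
        = Nat.choose (m + n) n + Nat.choose (m + n) (n + 1) := by
          rw [show m + (n + 1) = m + n + 1 from rfl, Nat.choose_succ_succ]
      _ ≤ Nat.choose (m + n) n + Nat.choose (m + n) n * m := Nat.add_le_add_left h2 _
      _ = Nat.choose (m + n) n * (m + 1) := by ring
      _ ≤ (m + 1) ^ n * (m + 1) := Nat.mul_le_mul_right _ ih
      _ = (m + 1) ^ (n + 1) := by rw [pow_succ]

/-- **Descartes base of the recursion**: every format with `1 ≤ N ≤ T` letters has `ζ(m,N) ≤ (m+1)^(T−1)`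
(tree `stub_descartesCeiling`: `ζ(m,N) + 1 ≤ C(m+N−1, m)`, then `C(m+N−1,m) ≤ (m+1)^(N−1) ≤ (m+1)^(T−1)`). [folklore] -/
theorem posRootLawAt_base (m T N : ℕ) (hN : 1 ≤ N) (hNT : N ≤ T) : PosRootLawAt m N ((m + 1) ^ (T - 1)) := by
  obtain ⟨n, rfl⟩ : ∃ n, N = n + 1 := ⟨N - 1, by omega⟩
  intro d S _
  have h1 := stub_descartesCeiling (n + 1) m (Nat.succ_pos n) d S
  have h2 : m + (n + 1) - 1 = m + n := by omega
  rw [h2] at h1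
  have h3 : Nat.choose (m + n) m ≤ (m + 1) ^ (T - 1) :=
    (choose_add_le_succ_pow m n).trans (Nat.pow_le_pow_right (Nat.succ_pos m) (by omega))
  omega

/-! ## The dyadic induction -/

/-- **Level bound.**  Under the halving recursion with constants `a` and window threshold `w ≤ T`, `2 ≤ T`:
for every `j` there is a bound `G` valid for all formats with `1 ≤ N ≤ 2^j T` letters, and
`G ≤ (3 + 8am)^j ((m+1)^(T−1) + 2m + 4am² + 4 (2^j T (m+1))^a)`. [folklore] -/
theorem level_bound (a w m T : ℕ) (hwT : w ≤ T) (h2T : 2 ≤ T)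
    (hrec : ∀ (K k B₁ B₂ : ℕ), w ≤ K + 1 → 0 < k → k ≤ K →
      PosRootLawAt m k B₁ → PosRootLawAt m (K + 1 - k) B₂ →
      PosRootLawAt m (K + 1) (2 * (B₂ + m + 2 * (a * m * (B₁ + B₂ + m) + ((K + 1) * (m + 1)) ^ a))))
    (j : ℕ) :
    ∃ G : ℕ, (∀ N, 1 ≤ N → N ≤ 2 ^ j * T → PosRootLawAt m N G) ∧
      G ≤ (3 + 8 * a * m) ^ j *
        ((m + 1) ^ (T - 1) + (2 * m + 4 * a * m ^ 2 + 4 * (2 ^ j * T * (m + 1)) ^ a)) := by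
  induction j with
  | zero =>
    refine ⟨(m + 1) ^ (T - 1), fun N hN hNT => posRootLawAt_base m T N hN (by simpa using hNT), ?_⟩
    simp only [pow_zero, one_mul]
    exact Nat.le_add_right _ _
  | succ j ih =>
    obtain ⟨G, hG, hGle⟩ := ih
    have h2j : 2 ^ (j + 1) * T = 2 * (2 ^ j * T) := by ring
    refine ⟨2 * (G + m + 2 * (a * m * (G + G + m) + (2 ^ (j + 1) * T * (m + 1)) ^ a)), ?_, ?_⟩
    · intro N hN hNT
      by_cases hsmall : N ≤ 2 ^ j * T
      · refine fun d S hS => (hG N hN hsmall d S hS).trans ?_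
        omega
      · have hT' : T ≤ 2 ^ j * T := Nat.le_mul_of_pos_left T (Nat.two_pow_pos j)
        obtain ⟨K, rfl⟩ : ∃ K, N = K + 1 := ⟨N - 1, by omega⟩
        have hB₁ : PosRootLawAt m ((K + 1) / 2) G := hG _ (by omega) (by omega)
        have hB₂ : PosRootLawAt m (K + 1 - (K + 1) / 2) G := hG _ (by omega) (by omega)
        have hstep := hrec K ((K + 1) / 2) G G (by omega) (by omega) (by omega) hB₁ hB₂
        exact fun d S hS => (hstep d S hS).trans (Nat.mul_le_mul_left 2 (Nat.add_le_add_left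
          (Nat.mul_le_mul_left 2 (Nat.add_le_add_left
            (Nat.pow_le_pow_left (Nat.mul_le_mul_right (m + 1) hNT) a) _)) _))
    · have h2j' : 2 ^ j ≤ 2 ^ (j + 1) := Nat.pow_le_pow_right (by norm_num) (Nat.le_succ j)
      have hPP : (2 ^ j * T * (m + 1)) ^ a ≤ (2 ^ (j + 1) * T * (m + 1)) ^ a :=
        Nat.pow_le_pow_left (Nat.mul_le_mul_right (m + 1) (Nat.mul_le_mul_right T h2j')) a
      set R : ℕ := 3 + 8 * a * m with hR
      set P' : ℕ := (2 ^ (j + 1) * T * (m + 1)) ^ a with hP'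
      set X : ℕ := (m + 1) ^ (T - 1) + (2 * m + 4 * a * m ^ 2 + 4 * P') with hX
      have hG1 : G ≤ R ^ j * X :=
        hGle.trans (Nat.mul_le_mul_left _
          (Nat.add_le_add_left (Nat.add_le_add_left (Nat.mul_le_mul_left 4 hPP) _) _))
      have hRj : 0 < R ^ j := Nat.pow_pos (by omega)
      have hQX : 2 * m + 4 * a * m ^ 2 + 4 * P' ≤ X := Nat.le_add_left _ _
      have hXR : X ≤ R ^ j * X := Nat.le_mul_of_pos_left X hRj
      have e1 : 2 * (G + m + 2 * (a * m * (G + G + m) + P')) =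
          (2 + 8 * a * m) * G + (2 * m + 4 * a * m ^ 2 + 4 * P') := by ring
      calc 2 * (G + m + 2 * (a * m * (G + G + m) + P'))
          = (2 + 8 * a * m) * G + (2 * m + 4 * a * m ^ 2 + 4 * P') := e1
        _ ≤ (2 + 8 * a * m) * (R ^ j * X) + R ^ j * X :=
            Nat.add_le_add (Nat.mul_le_mul_left _ hG1) (hQX.trans hXR)
        _ = R ^ (j + 1) * X := by rw [hR]; ring

/-! ## The power-of-two envelope -/

/-- **Envelope.**  With `m + 1 ≤ 2^(L+1)`, `T ≤ c(L+1) + 2` and the level bound at `j = k + 1`, the real-row bound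
`2G + 1` is at most `2 ^ (C ((L+1)(k+1) + (L+1)²))` with `C = a(c+4) + 9a + c + 11`. [folklore] -/
theorem envelope (a c m L k T G : ℕ) (hm : m + 1 ≤ 2 ^ (L + 1)) (hT : T ≤ c * (L + 1) + 2)
    (hG : G ≤ (3 + 8 * a * m) ^ (k + 1) *
      ((m + 1) ^ (T - 1) + (2 * m + 4 * a * m ^ 2 + 4 * (2 ^ (k + 1) * T * (m + 1)) ^ a))) :
    2 * G + 1 ≤ 2 ^ ((a * (c + 4) + 9 * a + c + 11) * ((L + 1) * (k + 1) + (L + 1) ^ 2)) := by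
  -- the unit `E` and the yardstick `W = 2 ^ E`
  set E : ℕ := (L + 1) * (k + 1) + (L + 1) ^ 2 with hE
  set U : ℕ := 2 ^ (L + 1) with hU
  set V : ℕ := 2 ^ (k + 1) with hV
  have hE1 : L + 1 ≤ E := by rw [hE]; nlinarith
  have hE2 : k + 1 ≤ E := by rw [hE]; nlinarith
  have hE3 : (L + 1) * (L + 1) ≤ E := by rw [hE]; nlinarith
  have hE4 : (L + 1) * (k + 1) ≤ E := by rw [hE]; omega
  set W : ℕ := 2 ^ E with hW
  have hWpos : 0 < W := Nat.two_pow_pos E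
  have hW2 : 2 ≤ W := by
    calc (2 : ℕ) = 2 ^ 1 := by norm_num
      _ ≤ 2 ^ E := Nat.pow_le_pow_right (by norm_num) (by omega)
  have hU2 : 2 ≤ U := by
    calc (2 : ℕ) = 2 ^ 1 := by norm_num
      _ ≤ 2 ^ (L + 1) := Nat.pow_le_pow_right (by norm_num) (by omega)
  have hUpos : 0 < U := by omega
  have hUW : U ≤ W := Nat.pow_le_pow_right (by norm_num) hE1
  have hVW : V ≤ W := Nat.pow_le_pow_right (by norm_num) hE2
  have hULW : U ^ (L + 1) ≤ W := by
    rw [hU, ← pow_mul]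
    exact Nat.pow_le_pow_right (by norm_num) hE3
  have hUkW : U ^ (k + 1) ≤ W := by
    rw [hU, ← pow_mul]
    exact Nat.pow_le_pow_right (by norm_num) hE4
  have hmW : m ≤ W := by omega
  have hm1W : m + 1 ≤ W := hm.trans hUW
  have hLU : L + 1 ≤ U := (Nat.lt_two_pow_self : L + 1 < 2 ^ (L + 1)).le
  have hWle : ∀ {i i' : ℕ}, i ≤ i' → W ^ i ≤ W ^ i' := fun h => Nat.pow_le_pow_right hWpos h
  -- (1) the multiplier: `(3 + 8am)^(k+1) ≤ W^(8a+3)`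
  have hR : 3 + 8 * a * m ≤ U ^ (8 * a + 3) := by
    have h1 : 3 + 8 * a ≤ 2 ^ (8 * a + 2) := by
      have := (Nat.lt_two_pow_self : 8 * a + 2 < 2 ^ (8 * a + 2))
      omega
    have h2 : 2 ^ (8 * a + 2) ≤ U ^ (8 * a + 2) := Nat.pow_le_pow_left hU2 _
    calc 3 + 8 * a * m ≤ (3 + 8 * a) * U := by nlinarith [Nat.mul_le_mul_left (8 * a) hm, hU2]
      _ ≤ U ^ (8 * a + 2) * U := Nat.mul_le_mul_right _ (h1.trans h2)
      _ = U ^ (8 * a + 3) := by ring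
  have hRk : (3 + 8 * a * m) ^ (k + 1) ≤ W ^ (8 * a + 3) :=
    calc (3 + 8 * a * m) ^ (k + 1) ≤ (U ^ (8 * a + 3)) ^ (k + 1) := Nat.pow_le_pow_left hR _
      _ = (U ^ (k + 1)) ^ (8 * a + 3) := by ring
      _ ≤ W ^ (8 * a + 3) := Nat.pow_le_pow_left hUkW _
  -- (2) the Descartes base: `(m+1)^(T-1) ≤ W^(c+1)`
  have hD : (m + 1) ^ (T - 1) ≤ W ^ (c + 1) :=
    calc (m + 1) ^ (T - 1) ≤ U ^ (T - 1) := Nat.pow_le_pow_left hm _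
      _ ≤ U ^ (c * (L + 1) + 1) := Nat.pow_le_pow_right hUpos (by omega)
      _ = (U ^ (L + 1)) ^ c * U := by ring
      _ ≤ W ^ c * W := Nat.mul_le_mul (Nat.pow_le_pow_left hULW _) hUW
      _ = W ^ (c + 1) := by rw [pow_succ]
  -- (3) the threshold: `T ≤ W^(c+2)`
  have hTW : T ≤ W ^ (c + 2) := by
    have h1 : c + 2 ≤ 2 ^ (c + 1) := by
      have := (Nat.lt_two_pow_self : c + 1 < 2 ^ (c + 1))
      omega
    have h2 : 2 ^ (c + 1) ≤ U ^ (c + 1) := Nat.pow_le_pow_left hU2 _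
    calc T ≤ c * (L + 1) + 2 := hT
      _ ≤ (c + 2) * (L + 1) := by nlinarith
      _ ≤ (c + 2) * U := Nat.mul_le_mul_left _ hLU
      _ ≤ U ^ (c + 1) * U := Nat.mul_le_mul_right _ (h1.trans h2)
      _ = U ^ (c + 2) := by ring
      _ ≤ W ^ (c + 2) := Nat.pow_le_pow_left hUW _
  -- (4) the cushion: `4 (V T (m+1))^a ≤ W^(a(c+4)+2)`
  have h4W : 4 ≤ W ^ 2 :=
    calc (4 : ℕ) = 2 ^ 2 := by norm_num
      _ ≤ W ^ 2 := Nat.pow_le_pow_left hW2 2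
  have hP : 4 * (V * T * (m + 1)) ^ a ≤ W ^ (a * (c + 4) + 2) := by
    have h1 : V * T * (m + 1) ≤ W ^ (c + 4) :=
      calc V * T * (m + 1) ≤ W * W ^ (c + 2) * W :=
            Nat.mul_le_mul (Nat.mul_le_mul hVW hTW) hm1W
        _ = W ^ (c + 4) := by ring
    calc 4 * (V * T * (m + 1)) ^ a ≤ W ^ 2 * (W ^ (c + 4)) ^ a :=
          Nat.mul_le_mul h4W (Nat.pow_le_pow_left h1 _)
      _ = W ^ (a * (c + 4) + 2) := by ring
  -- (5) the small terms
  have h2m : 2 * m ≤ W ^ 2 :=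
    calc 2 * m ≤ W * W := Nat.mul_le_mul hW2 hmW
      _ = W ^ 2 := (sq W).symm
  have h4am : 4 * a * m ^ 2 ≤ W ^ (a + 4) := by
    have h1 : 4 * a ≤ 2 ^ (a + 2) := by
      have := (Nat.lt_two_pow_self : a < 2 ^ a).le
      calc 4 * a ≤ 4 * 2 ^ a := Nat.mul_le_mul_left 4 this
        _ = 2 ^ (a + 2) := by ring
    have h2 : 2 ^ (a + 2) ≤ W ^ (a + 2) := Nat.pow_le_pow_left hW2 _
    calc 4 * a * m ^ 2 ≤ W ^ (a + 2) * W ^ 2 :=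
          Nat.mul_le_mul (h1.trans h2) (Nat.pow_le_pow_left hmW 2)
      _ = W ^ (a + 4) := by rw [← pow_add]
  -- (6) assemble
  set X : ℕ := a * (c + 4) + a + c + 4 with hX
  have hsum : (m + 1) ^ (T - 1) + (2 * m + 4 * a * m ^ 2 + 4 * (V * T * (m + 1)) ^ a) ≤ W ^ (X + 2) :=
    calc (m + 1) ^ (T - 1) + (2 * m + 4 * a * m ^ 2 + 4 * (V * T * (m + 1)) ^ a)
        ≤ W ^ X + (W ^ X + W ^ X + W ^ X) :=
          Nat.add_le_add (hD.trans (hWle (by omega)))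
            (Nat.add_le_add (Nat.add_le_add (h2m.trans (hWle (by omega))) (h4am.trans (hWle (by omega))))
              (hP.trans (hWle (by omega))))
      _ = 4 * W ^ X := by ring
      _ ≤ W ^ 2 * W ^ X := Nat.mul_le_mul_right _ h4W
      _ = W ^ (X + 2) := by rw [← pow_add, add_comm]
  have hGW : G ≤ W ^ (8 * a + X + 5) :=
    calc G ≤ (3 + 8 * a * m) ^ (k + 1) *
          ((m + 1) ^ (T - 1) + (2 * m + 4 * a * m ^ 2 + 4 * (V * T * (m + 1)) ^ a)) := hG
      _ ≤ W ^ (8 * a + 3) * W ^ (X + 2) := Nat.mul_le_mul hRk hsum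
      _ = W ^ (8 * a + X + 5) := by rw [← pow_add]; ring_nf
  have h3W : 3 ≤ W ^ 2 := le_trans (by norm_num) h4W
  calc 2 * G + 1 ≤ 3 * W ^ (8 * a + X + 5) := by
        have : 1 ≤ W ^ (8 * a + X + 5) := Nat.one_le_pow _ _ hWpos
        omega
    _ ≤ W ^ 2 * W ^ (8 * a + X + 5) := Nat.mul_le_mul_right _ h3W
    _ = W ^ (a * (c + 4) + 9 * a + c + 11) := by rw [← pow_add, hX]; ring_nf
    _ = 2 ^ ((a * (c + 4) + 9 * a + c + 11) * E) := by rw [hW]; ring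

/-! ## The stub, unfolded -/

/-- **`HalvingRecursion → SesquiLaw`** (stub 5 of the line `halving-sweep-sesqui-law`, all formats; the hypothesis
and the conclusion are the line's `HalvingRecursion` and `SesquiLaw` with their one-line definitions unfolded):
run the halving recursion dyadically from the Descartes base `T = max (c(⌊log₂m⌋+1)) 2` up to level `⌊log₂ K⌋ + 1`,
bound the level by the power-of-two envelope, and pass to all real zeros by reflection; `K = 0` has no zeros.
Constant `C = a(c+4) + 9a + c + 11`. [folklore] -/
theorem sesquiLaw_of_halvingRecursion
    (h : ∃ a c : ℕ, ∀ (m K k B₁ B₂ : ℕ), c * (Nat.log 2 m + 1) ≤ K + 1 → 0 < k → k ≤ K →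
      PosRootLawAt m k B₁ → PosRootLawAt m (K + 1 - k) B₂ →
      PosRootLawAt m (K + 1) (2 * (B₂ + m + 2 * (a * m * (B₁ + B₂ + m) + ((K + 1) * (m + 1)) ^ a)))) :
    ∃ C : ℕ, ∀ m K : ℕ,
      RealRootLawAt m K (2 ^ (C * ((Nat.log 2 m + 1) * (Nat.log 2 K + 1) + (Nat.log 2 m + 1) ^ 2))) := by
  obtain ⟨a, c, hrec⟩ := h
  refine ⟨a * (c + 4) + 9 * a + c + 11, fun m K => ?_⟩
  rcases Nat.eq_zero_or_pos K with rfl | hK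
  · -- the `K = 0` format: the empty pencil is the constant matrix `0`; a constant determinant has no zeros
    intro d S _
    have h0 : (∑ l : Fin 0, ((Polynomial.X : Polynomial ℝ) ^ d l) • (S l).map Polynomial.C) =
        (0 : Matrix (Fin m) (Fin m) ℝ).map Polynomial.C := by simp
    rw [h0, ← RingHom.mapMatrix_apply, ← RingHom.map_det, Polynomial.roots_C]
    simp
  obtain ⟨G, hG, hGle⟩ := level_bound a (c * (Nat.log 2 m + 1)) m (max (c * (Nat.log 2 m + 1)) 2)
    (le_max_left _ _) (le_max_right _ _) (fun K k B₁ B₂ => hrec m K k B₁ B₂) (Nat.log 2 K + 1)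
  have hT1 : 1 ≤ max (c * (Nat.log 2 m + 1)) 2 := le_max_of_le_right (by norm_num)
  have hKle : K ≤ 2 ^ (Nat.log 2 K + 1) * max (c * (Nat.log 2 m + 1)) 2 :=
    calc K ≤ 2 ^ (Nat.log 2 K + 1) := (Nat.lt_pow_succ_log_self one_lt_two K).le
      _ ≤ 2 ^ (Nat.log 2 K + 1) * max (c * (Nat.log 2 m + 1)) 2 := Nat.le_mul_of_pos_right _ hT1
  have henv := envelope a c m (Nat.log 2 m) (Nat.log 2 K) _ G (Nat.lt_pow_succ_log_self one_lt_two m)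
    (max_le (Nat.le_add_right _ _) (Nat.le_add_left _ _)) hGle
  -- reflection `X ↦ −X` (tree `stub_negRoots`): all real zeros ≤ positive zeros of the pencil + positive zeros of
  -- the reflected symmetric pencil `(d, (−1)^(d l) • S l)` + 1
  intro d S hS
  have h1 := hG K hK hKle d S hS
  have h2 := hG K hK hKle d (fun l => ((-1 : ℝ) ^ d l) • S l) (fun l => (hS l).smul _)
  have h3 := stub_negRoots K m d S
  omega

end HalvingSweep

end Summit.ValiantsHypothesis.ValiantsHypothesis.Theorems.LacunarySymmetroidMatrixDescartes
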